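import Mathlib
import HarnessLib

/-!
# Legendre pairs: definitions, row sums, and the untwisting of multiplier groups by the centroid shift

A *Legendre pair* of (odd) length `ℓ` is a pair of `±1` sequences `a, b` indexed by `ZMod ℓ` whose periodic
autocorrelations satisfy `PAF_a(s) + PAF_b(s) = -2` for all `s ≠ 0` [Fletcher–Gysin–Seberry, Australas. J.
Combin. 23 (2001) 75–86]; via two circulant cores it yields a Hadamard matrix of order `2ℓ + 2`, and
`ℓ = 333` (order 668, the smallest order for which no Hadamard matrix is known) is the prominent open
length [Ramos–Hulak–de Queiroz, arXiv:2607.20765 (2026)].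

PROVED here, for general length `n` (`[NeZero n]`, no parity hypothesis):
* `rowsum_sq` — the row sums of a Legendre pair satisfy `(Σa)² + (Σb)² = 2` [FGS 2001, Lemma 1, the PSD
  identity at frequency 0], so each is `±1` (`pm_of_sq`) and a unit mod `n` (`exists_unit_rowsum`);
* `PAF_translate`, `legendrePair_translate` — PAF and the Legendre-pair property are invariant under
  independent cyclic translation of the two sequences;
* the CENTROID LEMMA `moment_affine` / `centroid_fixed` / `translate_invariant`: if `x : ZMod n → ℤ` is
  invariant under an affine map `i ↦ h i + c` (`h` a unit) then the first moment `m = Σ x_i · i` satisfies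
  `m = h m + c s` (`s` the row sum); so if `s` is a unit the centroid `μ = m / s` is fixed by every affine
  symmetry and the translate `i ↦ x (i + μ)` is invariant under every linear part `h` — the weighted form of
  [Baumert, *Cyclic Difference Sets*, LNM 182 (1971), Thm 3.6 (2), attributed to J. Jans]: a cyclic difference
  set with `gcd(k, v) = 1` has a shift fixed by all multipliers;
* `hInvariant_translate_centroid`, `exists_twisted_iff` — the Legendre-pair consequence
  [Kotsireas–Koutschan–Bulutoglu–Arquette–Turner–Ryan, Special Matrices 11 (2023) 20230105 =
  arXiv:2111.02105v3, §2 Definition 2, Theorem 2 (= Turner–Bulutoglu–Baczkowski–Geyer, JACo 55 (2022), Thm 4),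
  Lemmas 1–2, Corollary 1]: a multiplier in the broad sense (`x (t i) = x (i + c)` for some shift `c`)
  becomes a multiplier in the narrow sense (`x (t i) = x i`) after ONE cyclic shift of the sequence (the
  centroid shift), simultaneously for all `t`; hence, for any set `H` of units, a Legendre pair with both
  sequences twisted-`H`-invariant exists iff an `H`-invariant Legendre pair in the narrow sense of
  [arXiv:2607.20765, Definition 2] exists.  Ramos–Hulak–de Queiroz (p. 4) state that no assertion of their
  paper covers the broader notion; by this published corollary (their own reference [11]) all of them do.

Design choices.  Sequences are `ZMod n → ℤ` with an explicit `±1` predicate (`IsPM`) rather than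
`ZMod n → ℤˣ` or `Bool`, so that PAFs, row sums and compressions are plain integer sums; the length is a
`variable {n : ℕ} [NeZero n]`; `H` in `exists_twisted_iff` is an arbitrary `Set (ZMod n)ˣ` (no subgroup
structure is needed).  Deliberately NOT here: the DFT / PSD formulation, compressions, the Hadamard plug-in,
and any statement specific to `n = 333`.
No `sorry`, no new axioms.
-/

open Finset BigOperators

namespace Literature.Combinatorics.Designs.LegendrePairs

variable {n : ℕ} [NeZero n]

/-! ## §1 Definitions -/

/-- Periodic autocorrelation `PAF_c(s) = Σ_i c_i c_{i+s}` of an integer sequence indexed by `ZMod n`.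
[cite: FletcherGysinSeberry2001, §1] -/
def PAF (c : ZMod n → ℤ) (s : ZMod n) : ℤ := ∑ i, c i * c (i + s)

/-- The sequence is `±1`-valued. [folklore] -/
def IsPM (c : ZMod n → ℤ) : Prop := ∀ i, c i = 1 ∨ c i = -1

/-- `(a, b)` is a Legendre pair of length `n`: two `±1` sequences on `ZMod n` with
`PAF_a(s) + PAF_b(s) = -2` for every `s ≠ 0` (for odd `n` these give a Hadamard matrix of order `2n + 2`
by the two-circulant plug-in).  Row sums are NOT normalised here (they are `±1`, `rowsum_sq`).
[cite: FletcherGysinSeberry2001, §1] -/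
def LegendrePair (a b : ZMod n → ℤ) : Prop :=
  IsPM a ∧ IsPM b ∧ ∀ s : ZMod n, s ≠ 0 → PAF a s + PAF b s = -2

/-- First moment `Σ_i x_i · i` of an integer sequence, read in `ZMod n` (the numerator of the centroid). [cite: Baumert1971, Thm 3.6] -/
def moment (x : ZMod n → ℤ) : ZMod n := ∑ i, (x i : ZMod n) * i

/-- The cyclic translate `i ↦ x (i + μ)`. [folklore] -/
def translate (x : ZMod n → ℤ) (μ : ZMod n) : ZMod n → ℤ := fun i => x (i + μ)

/-- `t`-invariance in the narrow (untwisted) sense: `x (t i) = x i` for all `i`. [cite: RamosHulakDeQueiroz2026, Definition 2] -/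
def HInvariant (x : ZMod n → ℤ) (t : (ZMod n)ˣ) : Prop := ∀ i, x ((t : ZMod n) * i) = x i

/-- `t` is a multiplier of `x` in the broad (translation-twisted) sense: `x (t i) = x (i + c)` for some shift `c`
and all `i` — the multiplier-group notion of [cite: KotsireasEtAl2023, Definition 2]; the "broader condition" of
Ramos–Hulak–de Queiroz, arXiv:2607.20765, p. 4. -/
def TwistedInvariant (x : ZMod n → ℤ) (t : (ZMod n)ˣ) : Prop :=
  ∃ c : ZMod n, ∀ i, x ((t : ZMod n) * i) = x (i + c)

/-! ## §2 The centroid lemma -/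

/-- An affine symmetry `x (h i + c) = x i` (`h` a unit) transports the first moment: `m = h m + c s`,
`s` the row sum.  (The computation behind the fixed-shift theorems.) [cite: Baumert1971, Thm 3.6] -/
theorem moment_affine (x : ZMod n → ℤ) (h : (ZMod n)ˣ) (c : ZMod n)
    (hinv : ∀ i, x ((h : ZMod n) * i + c) = x i) :
    moment x = (h : ZMod n) * moment x + c * ((∑ i, x i : ℤ) : ZMod n) := by
  unfold moment
  have key : ∑ i, (x i : ZMod n) * i
      = ∑ i, (x ((h : ZMod n) * i + c) : ZMod n) * ((h : ZMod n) * i + c) := by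
    have := Equiv.sum_comp ((Units.mulLeft h).trans (Equiv.addRight c))
      (fun j => (x j : ZMod n) * j)
    rw [← this]
    rfl
  conv_lhs => rw [key]
  simp only [hinv]
  rw [Int.cast_sum, Finset.mul_sum, Finset.mul_sum, ← Finset.sum_add_distrib]
  refine Finset.sum_congr rfl fun i _ => ?_
  ring

/-- If the row sum is a unit `u` mod `n`, the centroid `μ := m · u⁻¹` is a fixed point of every affine
symmetry `i ↦ h i + c` of `x` — the weighted form of: "if `(k,v)=1` the unique shift with `e_1+⋯+e_k ≡ 0 (mod v)`
is fixed by every multiplier". [cite: Baumert1971, Thm 3.6 (2)] -/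
theorem centroid_fixed (x : ZMod n → ℤ) (u : (ZMod n)ˣ)
    (hu : (u : ZMod n) = ((∑ i, x i : ℤ) : ZMod n))
    (h : (ZMod n)ˣ) (c : ZMod n) (hinv : ∀ i, x ((h : ZMod n) * i + c) = x i) :
    (h : ZMod n) * (moment x * ↑u⁻¹) + c = moment x * ↑u⁻¹ := by
  have hm := moment_affine x h c hinv
  rw [← hu] at hm
  calc (h : ZMod n) * (moment x * ↑u⁻¹) + c
      = ((h : ZMod n) * moment x + c * (u : ZMod n)) * ↑u⁻¹ := by
        rw [add_mul, mul_assoc, mul_assoc, Units.mul_inv, mul_one]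
    _ = moment x * ↑u⁻¹ := by rw [← hm]

/-- Hence the translate of `x` by its centroid is invariant under the LINEAR part `h` of every affine symmetry.
[cite: KotsireasEtAl2023, Theorem 2] -/
theorem translate_invariant (x : ZMod n → ℤ) (u : (ZMod n)ˣ)
    (hu : (u : ZMod n) = ((∑ i, x i : ℤ) : ZMod n))
    (h : (ZMod n)ˣ) (c : ZMod n) (hinv : ∀ i, x ((h : ZMod n) * i + c) = x i) (i : ZMod n) :
    x ((h : ZMod n) * i + moment x * ↑u⁻¹) = x (i + moment x * ↑u⁻¹) := by
  have hfix := centroid_fixed x u hu h c hinv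
  have key := hinv (i + moment x * ↑u⁻¹)
  rw [mul_add, add_assoc, hfix] at key
  exact key

omit [NeZero n] in
/-- The broad condition `x (t i) = x (i + c)` is invariance under the affine map `i ↦ t i - t c`. [folklore] -/
lemma affine_of_twisted (x : ZMod n → ℤ) (t : (ZMod n)ˣ) (c : ZMod n)
    (hc : ∀ i, x ((t : ZMod n) * i) = x (i + c)) (i : ZMod n) :
    x ((t : ZMod n) * i + -((t : ZMod n) * c)) = x i := by
  have key := hc (i - c)
  rw [sub_add_cancel, mul_sub] at key
  rwa [sub_eq_add_neg] at key

/-- Sequence-level statement: if the row sum of `x` is a unit `u` mod `n`, the translate of `x` by its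
centroid `m · u⁻¹` is `t`-invariant in the narrow sense for EVERY broad (twisted) multiplier `t` of `x`
(so one shift untwists the whole multiplier group). [cite: KotsireasEtAl2023, Lemma 2] -/
theorem hInvariant_translate_centroid (x : ZMod n → ℤ) (u : (ZMod n)ˣ)
    (hu : (u : ZMod n) = ((∑ i, x i : ℤ) : ZMod n)) (t : (ZMod n)ˣ) (ht : TwistedInvariant x t) :
    HInvariant (translate x (moment x * ↑u⁻¹)) t := by
  obtain ⟨c, hc⟩ := ht
  intro i
  show x ((t : ZMod n) * i + moment x * ↑u⁻¹) = x (i + moment x * ↑u⁻¹)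
  exact translate_invariant x u hu t _ (affine_of_twisted x t c hc) i

/-! ## §3 Legendre pairs: row sums are `±1`, translation preserves the pair -/

/-- `(Σ_i c_i)^2 = Σ_s PAF_c(s)` (the PSD identity at frequency `0`). [cite: FletcherGysinSeberry2001, Lemma 1] -/
lemma sq_rowsum (c : ZMod n → ℤ) : (∑ i, c i) ^ 2 = ∑ s, PAF c s := by
  unfold PAF
  have h : ∀ i : ZMod n, ∑ s, c i * c (i + s) = ∑ j, c i * c j := fun i => by
    have := Equiv.sum_comp (Equiv.addLeft i) (fun j => c i * c j)
    simpa only [Equiv.coe_addLeft] using this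
  calc (∑ i, c i) ^ 2 = ∑ i, ∑ j, c i * c j := by rw [sq, Finset.sum_mul_sum]
    _ = ∑ i, ∑ s, c i * c (i + s) := Finset.sum_congr rfl fun i _ => (h i).symm
    _ = ∑ s, ∑ i, c i * c (i + s) := Finset.sum_comm

/-- `PAF_c(0) = n` for a `±1` sequence. [folklore] -/
lemma paf_zero (c : ZMod n → ℤ) (hc : IsPM c) : PAF c 0 = n := by
  unfold PAF
  have : ∀ i, c i * c (i + 0) = 1 := fun i => by
    rw [add_zero]; rcases hc i with h | h <;> rw [h] <;> norm_num
  rw [Finset.sum_congr rfl fun i _ => this i]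
  simp [ZMod.card]

/-- The row sums of a Legendre pair satisfy `(Σa)^2 + (Σb)^2 = 2`, i.e. both are `±1`
(PSD identity `|A(0)|^2 + |B(0)|^2 = 2n + 2 - 2n`). [cite: FletcherGysinSeberry2001, Lemma 1] -/
lemma rowsum_sq (a b : ZMod n → ℤ) (h : LegendrePair a b) :
    (∑ i, a i) ^ 2 + (∑ i, b i) ^ 2 = 2 := by
  rw [sq_rowsum, sq_rowsum, ← Finset.sum_add_distrib]
  have key : ∀ s : ZMod n, PAF a s + PAF b s = (if s = 0 then 2 * (n : ℤ) + 2 else 0) + (-2) := by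
    intro s; split_ifs with hs
    · subst hs; rw [paf_zero a h.1, paf_zero b h.2.1]; ring
    · rw [h.2.2 s hs]; ring
  rw [Finset.sum_congr rfl (fun s _ => key s), Finset.sum_add_distrib, Finset.sum_ite_eq',
    Finset.sum_const, Finset.card_univ, ZMod.card]
  simp only [Finset.mem_univ, if_true]
  ring

/-- `x^2 + y^2 = 2` over `ℤ` forces `x = ±1`. [folklore] -/
lemma pm_of_sq (x y : ℤ) (h : x ^ 2 + y ^ 2 = 2) : x = 1 ∨ x = -1 := by
  have h1 : x ≤ 1 := by nlinarith [sq_nonneg y, sq_nonneg (x - 2)]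
  have h2 : -1 ≤ x := by nlinarith [sq_nonneg y, sq_nonneg (x + 2)]
  have h3 : y ≤ 1 := by nlinarith [sq_nonneg x, sq_nonneg (y - 2)]
  have h4 : -1 ≤ y := by nlinarith [sq_nonneg x, sq_nonneg (y + 2)]
  interval_cases x <;> interval_cases y <;> omega

/-- A row sum equal to `±1` is (the image of) a unit of `ZMod n`. [folklore] -/
lemma exists_unit_rowsum (x : ZMod n → ℤ) (hx : (∑ i, x i) = 1 ∨ (∑ i, x i) = -1) :
    ∃ u : (ZMod n)ˣ, (u : ZMod n) = ((∑ i, x i : ℤ) : ZMod n) := by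
  rcases hx with h | h
  · exact ⟨1, by rw [h]; push_cast; rfl⟩
  · exact ⟨-1, by rw [h]; push_cast; rfl⟩

/-- The PAF is invariant under cyclic translation. [cite: FletcherGysinSeberry2001, §1] -/
lemma PAF_translate (x : ZMod n → ℤ) (μ s : ZMod n) : PAF (translate x μ) s = PAF x s := by
  unfold PAF translate
  have key := Equiv.sum_comp (Equiv.addRight μ) (fun j => x j * x (j + s))
  simp only [Equiv.coe_addRight] at key
  rw [← key]
  refine Finset.sum_congr rfl fun i _ => ?_
  rw [add_right_comm i s μ]

/-- Translating the two sequences INDEPENDENTLY preserves the Legendre-pair property (equivalence of LPs under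
`Z_ℓ × Z_ℓ`). [cite: KotsireasEtAl2023, §2] -/
lemma legendrePair_translate (a b : ZMod n → ℤ) (h : LegendrePair a b) (μ ν : ZMod n) :
    LegendrePair (translate a μ) (translate b ν) :=
  ⟨fun i => h.1 (i + μ), fun i => h.2.1 (i + ν),
   fun s hs => by rw [PAF_translate, PAF_translate]; exact h.2.2 s hs⟩

/-! ## §4 The two notions of common multiplier group have the same classification -/

/-- **Twisted and untwisted common multiplier groups have the same classification.**  For ANY set `H` of
units of `ZMod n`: a Legendre pair of length `n` both of whose sequences have every `t ∈ H` as a broad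
(translation-twisted) multiplier exists iff a Legendre pair that is `H`-invariant in the narrow sense of
Ramos–Hulak–de Queiroz (arXiv:2607.20765, Definition 2) exists (`→`: translate each sequence by its own centroid;
`←`: take `c = 0`).  Consequently every existence / nonexistence assertion about `H`-invariant Legendre pairs of
length 333 in arXiv:2607.20765 (Theorem 1, Table A1) holds verbatim for the broader notion its p. 4 declares out
of scope. [cite: KotsireasEtAl2023, Corollary 1] -/
theorem exists_twisted_iff (H : Set (ZMod n)ˣ) :
    (∃ a b : ZMod n → ℤ, LegendrePair a b ∧
        (∀ t ∈ H, TwistedInvariant a t) ∧ (∀ t ∈ H, TwistedInvariant b t)) ↔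
    (∃ a b : ZMod n → ℤ, LegendrePair a b ∧
        (∀ t ∈ H, HInvariant a t) ∧ (∀ t ∈ H, HInvariant b t)) := by
  constructor
  · rintro ⟨a, b, hab, ha, hb⟩
    have hsq := rowsum_sq a b hab
    obtain ⟨u, hu⟩ := exists_unit_rowsum a (pm_of_sq _ _ hsq)
    obtain ⟨v, hv⟩ := exists_unit_rowsum b (pm_of_sq _ _ (by rw [add_comm]; exact hsq))
    exact ⟨translate a (moment a * ↑u⁻¹), translate b (moment b * ↑v⁻¹),
      legendrePair_translate a b hab _ _,
      fun t ht => hInvariant_translate_centroid a u hu t (ha t ht),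
      fun t ht => hInvariant_translate_centroid b v hv t (hb t ht)⟩
  · rintro ⟨a, b, hab, ha, hb⟩
    exact ⟨a, b, hab, fun t ht => ⟨0, fun i => by rw [add_zero]; exact ha t ht i⟩,
      fun t ht => ⟨0, fun i => by rw [add_zero]; exact hb t ht i⟩⟩

end Literature.Combinatorics.Designs.LegendrePairs
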